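/-
Copyright (c) 2026. All rights reserved.
Released under Apache 2.0 license as described in the file LICENSE.
Authors: abc-iut cell, seat abc-iut-w6-d023 (gen 3; block C / W6), answering the open question left by seat
abc-iut-f-081 (`FrobeniusPictureMLFCompatNecessity.lean`, `…NecessityTelecore.lean`).
-/
import Literature.AnabelianGeometry.AbsoluteAnabelian.AbsTopIII.FrobeniusPictureMLFLogGlueFamily
import Literature.AnabelianGeometry.AbsoluteAnabelian.AbsTopIII.FrobeniusPictureMLFTelecore
import Mathlib.CategoryTheory.SingleObj
import Mathlib.Data.ZMod.Basic
import Mathlib.Tactic.Ring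
import HarnessLib

/-!
# [AbsTopIII] Cor. 3.6 (iii), second clause: the LITERAL cores clause does NOT force `ι_×`, `ι_{log,⋎}` to lie
# over the IDENTITY of `ℰ` — a twisted toy datum separating `LogObsCompatCoresStmt` from F-0360

S. Mochizuki, *Topics in Absolute Anabelian Geometry III* [MochizukiAbsTopIII2015] (kurims `paper:url-5493eb38cbb7`):
Cor. 3.6 (iii) p. 80 ("[the family of homotopies of `𝔖_log`] is compatible with the families of homotopies that
constitute the core and telecore structures of (i), (ii)"), proof p. 81 l. 21–26 ("… because the various Galois
groups that appear remain 'undisturbed' …"); Def. 3.5 (ii) p. 75 (families of homotopies), (iii) (cores).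
Two typings of the clause live in the tree (abc-iut-L4-t5): the LITERAL Def. 3.5 (ii) reading
`LogObsCompatCoresStmt Δ` (ONE family on `𝒟` containing the `𝔖_log` family and core families for `(𝒟_{≤4}, ℰ)`,
`(𝒟_{≤5}, Anab)`, `(𝒟_{≤6}, ℰ)`) and the CONTENT reading `IotaOverGaloisStmt Δ` (FACT-LIST F-0360: after `𝒩 → ℰ`
the components of `ι_×`, `ι_{log,⋎}` are identities).  Known: F-0360 ⟹ literal (abc-iut-w5-d053,
`logObsCompatCoresStmt_of_iotaOverGaloisStmt`); literal ⟹ Galois components ISO (abc-iut-f-081,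
`isIso_NtoE_map_iotaTimes_of_logObsCompatCoresStmt`), who left OPEN whether the identities are forced and sketched a
"twisted toy" (STATUS 2026-08-26T09:06:16Z).  This file settles it: **they are not.**

* `TwistedToy.datum` — all six categories `B(ℤ/2)`, every functor of Def. 3.1's shape the identity, `log ≅ 𝟭` the
  identity, `ι_× = ι_{log,⋎} :=` the non-trivial CENTRAL element `g`.  (f-081's sketch let `𝒳 → ℰ` kill the
  generator; the field `η : (𝒳 → ℰ) ⋙ κ ⋙ φ ≅ 𝟭_𝒳` forces `𝒳 → ℰ` to be an equivalence, so the twist must be a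
  central natural automorphism instead.)
* `TwistedToy.family` — ONE family of homotopies on `𝒟` (Def. 3.5 (ii) laws PROVED): boundary set = the glued set
  `GlueE` of abc-iut-L4-t5 (pairs through a core vertex ∪ `E_log` pairs into `𝒩`), homotopy of `([γ₁],[γ₂])` =
  `g ^ (#λ^{×pf}-edges of γ₂ − #λ^{×pf}-edges of γ₁)` — a "twisted universal family".
* `TwistedToy.logObsCompatCoresStmt` / `TwistedToy.not_iotaOverGaloisStmt` — the literal clause HOLDS at the datum
  (its pullback to `𝒟_{≤3}` IS an `𝔖_log` family; the pairs into rows 4–6 are cores; abc-iut-L4-t5's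
  `logObsCompatCoresStmt_of_pull`) while F-0360 FAILS (`g ≠ 1`); assembled:
  `exists_logObsCompatCoresStmt_not_iotaOverGaloisStmt`, `not_forall_iotaOverGaloisStmt_of_logObsCompatCoresStmt`.
* Family-free bookkeeping for the pullback of ANY family with boundary set `GlueE` (`isGeneratedBy_pullLog_of_glueE`).

UPSHOT for the node ledger (AbsTopIII:Cor3.6(iii) / Cor4.5(iii), second clause): as typed, the literal clause is
STRICTLY WEAKER than its recorded content F-0360 (sufficient, w5-d053; not necessary, here); its exact strength
lies between "Galois components invertible" (f-081) and "identities" (F-0360).  Print's proof argues the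
identities, which is what the models verify (`TFModel.iotaOverGaloisStmt_model`, `AbsTopIII.arch_iotaOverGaloisStmt`).
HONEST FRAMING: category-theoretic bookkeeping over the typed data and a toy datum (toy ≠ model); refereed pre-IUT
material; calibration of two typings of one printed clause; nothing here bears on [IUTchIII] Cor. 3.12 or takes a
side; typed ≠ proved.
-/

namespace Literature.AnabelianGeometry.AbsoluteAnabelian

open _root_.CategoryTheory _root_.Quiver

namespace LogFrobeniusData

open DiagramOfCategories

/-! ### The pullback to `𝒟_{≤3}` of a family with boundary set `GlueE` is generated by the `𝔖_log` pairs -/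

section Generic

universe u

variable (Δ : LogFrobeniusData.{u})

/-- No edge of `𝒟_{≤3}` leaves `𝒩` (observables have no edge out of `v_𝒮`, Def. 3.5 (iii) (b)).
[cite: MochizukiAbsTopIII2015, Definition 3.5 (iii) p.75] -/
theorem isEmpty_hom_lvObs (b : logObsShape.{u}.Vertex) : IsEmpty (lvObs.{u} ⟶ b) := by
  rcases b with _ | _ <;> exact ⟨fun e => PEmpty.elim e⟩

/-- Every pair in the saturation `E_log` of the type-(1)/(2) generators ends at `𝒩` ("every boundary set path
… has terminal vertex `v_𝒮`"). [cite: MochizukiAbsTopIII2015, Corollary 3.6 (iii) p.81] -/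
theorem eq_lvObs_of_saturation_logGen {a b : logObsShape.{u}.Vertex} {p q : Path a b}
    (h : Saturation Δ.LogGen p q) : b = lvObs.{u} := by
  induction h with
  | base h => cases h <;> rfl
  | refl_left _ ih => exact ih
  | refl_right _ ih => exact ih
  | trans _ _ ih _ => exact ih
  | precomp r _ ih => exact ih
  | postcomp r _ ih =>
    subst ih
    exact eq_of_path_of_isEmpty_hom isEmpty_hom_lvObs r

/-- A glued image pair into `𝒩` comes from an `E_log` pair (family-free form of abc-iut-w5-d053's
`logE_of_glueE_mapPath`: the lift of `embLog[γ]` is `γ`). [cite: MochizukiAbsTopIII2015, Corollary 3.6 (iii) p.81] -/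
theorem saturation_of_glueE_mapPath {a₀ : logObsShape.{u}.Vertex} (p q : Path a₀ lvObs)
    (h : Δ.GlueE (embLog.mapPath p) (embLog.mapPath q)) : Saturation Δ.LogGen p q := by
  have hs := Δ.saturation_of_glueE_third h
  rcases a₀ with ⟨v, hv⟩ | _
  · rcases v with n | _ | _ | _ | _ | _
    · exact Δ.saturation_transport (eq_of_heq (liftLogPath_mapPath.{u} p le_rfl))
        (eq_of_heq (liftLogPath_mapPath.{u} q le_rfl)) hs
    · exact Δ.saturation_transport (eq_of_heq (liftLogPath_mapPath.{u} p le_rfl))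
        (eq_of_heq (liftLogPath_mapPath.{u} q le_rfl)) hs
    all_goals exact absurd hv (by simp [LFVertex.row])
  · exact Δ.saturation_transport (eq_of_heq (liftLogPath_mapPath.{u} p le_rfl))
      (eq_of_heq (liftLogPath_mapPath.{u} q le_rfl)) hs

/-- An `E_log` pair maps to a glued pair (family-free form of abc-iut-w5-d053's `glueE_mapPath_of_logE`).
[cite: MochizukiAbsTopIII2015, Corollary 3.6 (iii) p.81] -/
theorem glueE_mapPath_of_saturation {a₀ : logObsShape.{u}.Vertex} (p q : Path a₀ lvObs)
    (hs : Saturation Δ.LogGen p q) : Δ.GlueE (embLog.mapPath p) (embLog.mapPath q) := by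
  rcases a₀ with ⟨v, hv⟩ | _
  · rcases v with n | _ | _ | _ | _ | _
    · exact GlueE.log (Δ.saturation_transport (eq_of_heq (liftLogPath_mapPath.{u} p le_rfl)).symm
        (eq_of_heq (liftLogPath_mapPath.{u} q le_rfl)).symm hs)
    · exact GlueE.log (Δ.saturation_transport (eq_of_heq (liftLogPath_mapPath.{u} p le_rfl)).symm
        (eq_of_heq (liftLogPath_mapPath.{u} q le_rfl)).symm hs)
    all_goals exact absurd hv (by simp [LFVertex.row])
  · exact GlueE.log (Δ.saturation_transport (eq_of_heq (liftLogPath_mapPath.{u} p le_rfl)).symm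
      (eq_of_heq (liftLogPath_mapPath.{u} q le_rfl)).symm hs)

/-- **For ANY family `K` on `𝒟` whose boundary set is the glued set `GlueE`, the pullback of `K` to `𝒟_{≤3}` is
GENERATED by the type-(1)/(2) pairs** (Def. 3.5 (ii) "generated"; "`E_log` = the saturation of the pairs of the
three types", proof of (iii) p. 81): into `𝒩` the glued pairs are exactly the `E_log` pairs, and no glued pair ends
in rows 1–2. [cite: MochizukiAbsTopIII2015, Corollary 3.6 (iii) p.81] -/
theorem isGeneratedBy_pullLog_of_glueE (K : Δ.diagram.HomotopyFamily)
    (hK : ∀ ⦃a b : LFVertex⦄ (P Q : Path a b), K.E P Q ↔ Δ.GlueE P Q) :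
    HomotopyFamily.IsGeneratedBy _ (Δ.pullLog K) Δ.LogGen := by
  intro a b p q
  rw [Δ.pullLog_E_iff K p q, hK]
  rcases b with ⟨v, hv⟩ | _
  · constructor
    · intro h; exact (Δ.glueE_false_of_row_le_two hv h).elim
    · intro h; exact absurd (Δ.eq_lvObs_of_saturation_logGen h) (by rintro ⟨⟩)
  · exact ⟨Δ.saturation_of_glueE_mapPath p q, Δ.glueE_mapPath_of_saturation p q⟩

end Generic

/-! ### The twisted toy datum -/

namespace TwistedToy

/-- The group of the twist: `ℤ/2`, written multiplicatively. [folklore] -/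
abbrev Grp : Type := Multiplicative (ZMod 2)

/-- The one-object category of `ℤ/2`: ALL six categories of the datum. [folklore] -/
abbrev Cat : Type := CategoryTheory.SingleObj Grp

/-- The twisting element `g` (the generator of `ℤ/2`). [folklore] -/
def gen : Grp := Multiplicative.ofAdd (1 : ZMod 2)

/-- `g ≠ 1`. [folklore] -/
private theorem gen_ne_one : gen ≠ 1 := fun h => absurd (congrArg Multiplicative.toAdd h) (by decide)

/-- `ι_× := g`, a CENTRAL natural endo-transformation of `λ^× = 𝟭 = λ^{×pf}`.
[cite: MochizukiAbsTopIII2015, Corollary 3.6 (ii) p.79] -/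
def iotaTimes : 𝟭 Cat ⟶ 𝟭 Cat where
  app _ := gen
  naturality _ _ f := mul_comm gen (f : Grp)

/-- `ι_{log,⋎} := g` as a transformation `(log ⋙ id_⋎) ⋙ λ^× ⟶ id_⋎ ⋙ λ^{×pf}` (all functors identities).
[cite: MochizukiAbsTopIII2015, Corollary 3.6 (ii) p.79] -/
def iotaLog : (𝟭 Cat ⋙ 𝟭 Cat) ⋙ 𝟭 Cat ⟶ 𝟭 Cat ⋙ 𝟭 Cat where
  app _ := gen
  naturality _ _ f := mul_comm gen (f : Grp)

/-- **The twisted toy datum** of Def. 3.1's shape: every category `B(ℤ/2)`, every functor (`log`, `id_⋎`, `λ^×`,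
`λ^{×pf}`, `𝒳 → ℰ`, `𝒩 → ℰ`, `κ`, `Anab → ℰ`, `φ`) the identity, `log ≅ 𝟭` and `η` identities, and
`ι_× = ι_{log,⋎} = g` (holomorphic orientation `ι_× : λ^× → λ^{×pf}`).  A toy, not a model of the printed data.
[cite: MochizukiAbsTopIII2015, Corollary 3.6 (ii) p.79] -/
def datum : LogFrobeniusData.{0} where
  X₁ := Cat
  X := Cat
  toNexus := 𝟭 _
  N := Cat
  E := Cat
  A := Cat
  log := 𝟭 _
  logIsoId := Iso.refl _
  lamTimes := 𝟭 _
  lamPf := 𝟭 _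
  ιlog := iotaLog
  ιtimes := Sum.inl iotaTimes
  XtoE := 𝟭 _
  NtoE := 𝟭 _
  lamTimes_NtoE := Functor.comp_id _
  lamPf_NtoE := Functor.comp_id _
  κ := 𝟭 _
  AtoE := 𝟭 _
  κ_equiv := inferInstance
  κ_inv := Functor.rightUnitor _
  φ := 𝟭 _
  φ_equiv := inferInstance
  η := Functor.rightUnitor _ ≪≫ Functor.rightUnitor _

/-! ### Morphisms of the vertex categories as elements of `ℤ/2` -/

/-- The element of `ℤ/2` underlying a morphism of the category at the vertex `v` of `𝒟` (each is `B(ℤ/2)`; the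
vertex is matched so that the statement is uniform in `v`). [folklore] -/
def val : ∀ (v : LFVertex) {x y : datum.diagram.obj v}, (x ⟶ y) → Grp
  | .row1 _, _, _, f => f
  | .nexus, _, _, f => f
  | .third, _, _, f => f
  | .fourth, _, _, f => f
  | .fifth, _, _, f => f
  | .sixth, _, _, f => f

/-- The morphism with a prescribed underlying element. [folklore] -/
def ofVal : ∀ (v : LFVertex) (x y : datum.diagram.obj v), Grp → (x ⟶ y)
  | .row1 _, _, _, g => g
  | .nexus, _, _, g => g
  | .third, _, _, g => g
  | .fourth, _, _, g => g
  | .fifth, _, _, g => g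
  | .sixth, _, _, g => g

/-- `val ∘ ofVal = id`. [folklore] -/
private theorem val_ofVal (v : LFVertex) (x y : datum.diagram.obj v) (g : Grp) : val v (ofVal v x y g) = g := by
  cases v <;> rfl

/-- `ofVal ∘ val = id`. [folklore] -/
private theorem ofVal_val (v : LFVertex) {x y : datum.diagram.obj v} (f : x ⟶ y) : ofVal v x y (val v f) = f := by
  cases v <;> rfl

/-- A morphism is determined by its underlying element. [folklore] -/
private theorem val_injective (v : LFVertex) {x y : datum.diagram.obj v} {f g : x ⟶ y} (h : val v f = val v g) :
    f = g := by
  rw [← ofVal_val v f, ← ofVal_val v g, h]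

/-- Composition multiplies underlying elements. [folklore] -/
private theorem val_comp (v : LFVertex) {x y z : datum.diagram.obj v} (f : x ⟶ y) (g : y ⟶ z) :
    val v (f ≫ g) = val v g * val v f := by
  cases v <;> rfl

/-- Identities have underlying element `1`. [folklore] -/
private theorem val_id (v : LFVertex) (x : datum.diagram.obj v) : val v (𝟙 x) = 1 := by
  cases v <;> rfl

/-- `eqToHom`s have underlying element `1`. [folklore] -/
private theorem val_eqToHom (v : LFVertex) {x y : datum.diagram.obj v} (h : x = y) : val v (eqToHom h) = 1 := by
  cases h; exact val_id v x

/-- A functor between vertex categories PRESERVES UNDERLYING ELEMENTS. [folklore] -/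
private def PreservesVal {a b : LFVertex} (F : datum.diagram.obj a ⥤ datum.diagram.obj b) : Prop :=
  ∀ ⦃x y : datum.diagram.obj a⦄ (f : x ⟶ y), val b (F.map f) = val a f

/-- The identity functor preserves underlying elements. [folklore] -/
private theorem preservesVal_id (a : LFVertex) : PreservesVal (𝟭 (datum.diagram.obj a)) :=
  fun _ _ _ => rfl

/-- Composites of element-preserving functors preserve elements. [folklore] -/
private theorem PreservesVal.comp {a b c : LFVertex} {F : datum.diagram.obj a ⥤ datum.diagram.obj b}
    {G : datum.diagram.obj b ⥤ datum.diagram.obj c} (hF : PreservesVal F) (hG : PreservesVal G) :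
    PreservesVal (F ⋙ G) :=
  fun _ _ f => (hG (F.map f)).trans (hF f)

/-- Every edge functor of the toy diagram `𝒟` (an identity functor) preserves underlying elements.
[cite: MochizukiAbsTopIII2015, Corollary 3.6 p.78] -/
private theorem preservesVal_map : ∀ {a b : LFVertex} (e : a ⟶ b), PreservesVal (datum.diagram.map e) := by
  intro a b e
  cases a <;> cases b <;>
    first
      | exact (PEmpty.elim e)
      | (intro x y f; rfl)
      | (rcases e with ⟨_ | _⟩ <;> intro x y f <;> rfl)

/-- Every path functor `𝒟_[γ]` of the toy diagram preserves underlying elements (Def. 3.5 (i)).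
[cite: MochizukiAbsTopIII2015, Definition 3.5 (i) p.74] -/
private theorem preservesVal_pathFunctor {a b : LFVertex} (p : Path a b) : PreservesVal (datum.diagram.pathFunctor p) := by
  induction p with
  | nil => rw [pathFunctor_nil]; exact preservesVal_id a
  | cons p e ih => rw [pathFunctor_cons]; exact ih.comp (preservesVal_map e)

/-! ### The twist: the number of `λ^{×pf}`-edges of a path, mod 2 -/

/-- Weight of an edge: `1` for `λ^{×pf} : □ → 𝒩`, `0` otherwise. [cite: MochizukiAbsTopIII2015, Corollary 3.6 p.78] -/
def edgeWt : ∀ {a b : LFVertex}, (a ⟶ b) → ZMod 2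
  | .nexus, .third, e => if (ULift.down e : Bool) then 0 else 1
  | _, _, _ => 0

/-- Weight of a path: the number of its `λ^{×pf}`-edges mod 2. [cite: MochizukiAbsTopIII2015, Corollary 3.6 p.78] -/
def pathWt : ∀ {a b : LFVertex}, Path a b → ZMod 2
  | _, _, .nil => 0
  | _, _, .cons p e => pathWt p + edgeWt e

/-- The empty path has weight `0`. [folklore] -/
@[simp] private theorem pathWt_nil (a : LFVertex) : pathWt (Path.nil : Path a a) = 0 := by
  rw [pathWt]

/-- Weight of an extended path. [folklore] -/
@[simp] private theorem pathWt_cons {a b c : LFVertex} (p : Path a b) (e : b ⟶ c) :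
    pathWt (p.cons e) = pathWt p + edgeWt e := by
  rw [pathWt]

/-- The weight is additive under composition of paths. [folklore] -/
private theorem pathWt_comp {a b c : LFVertex} (p : Path a b) (q : Path b c) :
    pathWt (p.comp q) = pathWt p + pathWt q := by
  induction q with
  | nil => simp
  | cons q e ih => rw [Path.comp_cons, pathWt_cons, pathWt_cons, ih, add_assoc]

/-! ### The twisted homotopies and the family -/

/-- **The twisted homotopy** of a co-verticial pair `([γ₁],[γ₂])`: the natural transformation
`𝒟_[γ₁] ⟶ 𝒟_[γ₂]` all of whose components are the central element `g ^ (wt γ₂ − wt γ₁)` (natural because every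
path functor preserves underlying elements and `ℤ/2` is commutative).
[cite: MochizukiAbsTopIII2015, Definition 3.5 (ii) p.75] -/
def eta {a b : LFVertex} (p q : Path a b) : datum.diagram.pathFunctor p ⟶ datum.diagram.pathFunctor q where
  app x := ofVal b _ _ (Multiplicative.ofAdd (pathWt q - pathWt p))
  naturality x y f := by
    apply val_injective b
    rw [val_comp, val_comp, val_ofVal, val_ofVal, preservesVal_pathFunctor p f, preservesVal_pathFunctor q f]
    exact mul_comm _ _

/-- The underlying element of a component of the twisted homotopy. [folklore] -/
private theorem val_eta_app {a b : LFVertex} (p q : Path a b) (x : datum.diagram.obj a) :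
    val b ((eta p q).app x) = Multiplicative.ofAdd (pathWt q - pathWt p) :=
  val_ofVal b _ _ _

/-- **The twisted family of homotopies on `𝒟`** (Def. 3.5 (ii)): boundary set = the glued set `GlueE` (pairs
through a core vertex of rows 4–6 ∪ `E_log`-pairs into `𝒩`; saturated, abc-iut-L4-t5), homotopy of a pair = its
twisted homotopy; the identity law (`wt γ − wt γ = 0`), the composition law (exponents add) and the whiskering
law (weights are additive along paths and path functors preserve underlying elements) are PROVED.
[cite: MochizukiAbsTopIII2015, Definition 3.5 (ii) p.75] -/
def family : datum.diagram.HomotopyFamily where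
  E := datum.GlueE
  isSaturated := datum.isSaturated_glueE
  η := fun _ _ p q _ => eta p q
  η_refl := by
    intro a b p _
    ext x
    apply val_injective b
    rw [val_eta_app, NatTrans.id_app, val_id, sub_self, ofAdd_zero]
  η_trans := by
    intro a b p q r _ _
    ext x
    apply val_injective b
    rw [NatTrans.comp_app, val_comp, val_eta_app, val_eta_app, val_eta_app, ← ofAdd_add]
    congr 1
    ring
  η_whisker := by
    intro a b c d p q _ r₁ r₂
    ext x
    apply val_injective d
    rw [val_eta_app, NatTrans.comp_app, NatTrans.comp_app, val_comp, val_comp, eqToHom_app,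
      eqToHom_app, val_eqToHom, val_eqToHom, Functor.whiskerLeft_app, Functor.whiskerRight_app,
      one_mul, mul_one]
    erw [preservesVal_pathFunctor r₂ ((eta p q).app _)]
    rw [val_eta_app, pathWt_comp, pathWt_comp, pathWt_comp, pathWt_comp]
    congr 1
    ring

/-! ### The pairs into the row-4/5/6 vertices are cores -/

/-- `(𝒟_{≤4}, ℰ)` is a core for the pulled-back pairs of the twisted family (all pairs into `ℰ` are glued pairs;
pattern of abc-iut-w5-d053's `logObsCompatCoresStmt_of_glueCross`). [cite: MochizukiAbsTopIII2015, Corollary 3.6 (i) p.79] -/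
theorem isCore4 : (datum.coreObs4 (datum.coreFamily4Of family) (fun _ _ _ _ h => h.1)).IsCore :=
  ⟨fun _ p q => ⟨rfl, (datum.pullCore4_E_iff family p q).mpr (GlueE.univ
      (univE_of_mem coreVertices (Or.inl rfl) (embCore4.mapPath p) (embCore4.mapPath q)))⟩, reaches4⟩

/-- `(𝒟_{≤5}, Anab)` is a core for the pulled-back pairs of the twisted family.
[cite: MochizukiAbsTopIII2015, Corollary 3.6 (i) p.79] -/
theorem isCore5 : (datum.coreObs5 (datum.coreFamily5Of family) (fun _ _ _ _ h => h.1)).IsCore :=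
  ⟨fun _ p q => ⟨rfl, (datum.pullCore5_E_iff family p q).mpr (GlueE.univ
      (univE_of_mem coreVertices (Or.inr (Or.inl rfl)) (embCore5.mapPath p) (embCore5.mapPath q)))⟩,
    reaches5⟩

/-- `(𝒟_{≤6}, ℰ)` is a core for the pulled-back pairs of the twisted family.
[cite: MochizukiAbsTopIII2015, Corollary 3.6 (i) p.79] -/
theorem isCore6 : (datum.coreObs6 (datum.coreFamily6Of family) (fun _ _ _ _ h => h.1)).IsCore :=
  ⟨fun _ p q => ⟨rfl, (datum.pullCore6_E_iff family p q).mpr (GlueE.univ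
      (univE_of_mem coreVertices (Or.inr (Or.inr rfl)) (embCore6.mapPath p) (embCore6.mapPath q)))⟩,
    reaches6⟩

/-! ### The pullback of the twisted family to `𝒟_{≤3}` is an `𝔖_log` family -/

/-- Components of heterogeneously equal natural transformations between equal functors agree. [folklore] -/
private theorem heq_app_of_heq {C D : Type*} [Category C] [Category D] {F G F' G' : C ⥤ D}
    (hF : F = F') (hG : G = G') {α : F ⟶ G} {β : F' ⟶ G'} (h : HEq α β) (X : C) :
    HEq (α.app X) (β.app X) := by
  subst hF hG
  rw [heq_iff_eq] at h
  subst h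
  rfl

/-- In a one-object category an `eqToHom`-sandwich of a morphism has the same underlying element. [folklore] -/
private theorem singleObj_sandwich {M : Type} [Monoid M] {a b c d : CategoryTheory.SingleObj M} (h₁ : a = b)
    (g : b ⟶ c) (h₂ : c = d) : ((eqToHom h₁ ≫ g ≫ eqToHom h₂ : a ⟶ d) : M) = (g : M) := by
  subst h₁ h₂
  simp

/-- The type-(2) basic pair `([λ^×],[λ^{×pf}])` is a boundary pair of the pullback.
[cite: MochizukiAbsTopIII2015, Corollary 3.6 (iii) p.81] -/
theorem pullLog_E_timesPair :
    (datum.pullLog family).E ((Path.nil : Path lvNexus.{0} lvNexus).cons eLamTimes)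
      ((Path.nil : Path lvNexus.{0} lvNexus).cons eLamPf) :=
  (datum.pullLog_E_iff family _ _).mpr (datum.glueE_mapPath_of_saturation _ _ (Saturation.base LogGen.type2))

/-- The type-(1) basic pairs `([λ^×]∘[id_⋎]∘[log], [λ^{×pf}]∘[id_{⋎+1}])` are boundary pairs of the pullback.
[cite: MochizukiAbsTopIII2015, Corollary 3.6 (iii) p.81] -/
theorem pullLog_E_logPair (n : ℤ) : (datum.pullLog family).E (logPairLeft.{0} n) (logPairRight.{0} n) :=
  (datum.pullLog_E_iff family _ _).mpr (datum.glueE_mapPath_of_saturation _ _ (Saturation.base (LogGen.type1 n)))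

/-- `𝒟_{≤3,[λ^×]} = 𝒟_{[λ^×]}` (the presentation has the path functors of `𝒟`). [cite: MochizukiAbsTopIII2015, Corollary 3.6 (iii) p.80] -/
theorem sub3_pathFunctor_timesLeft :
    datum.sub3.pathFunctor ((Path.nil : Path lvNexus.{0} lvNexus).cons eLamTimes) =
      datum.diagram.pathFunctor (embLog.mapPath ((Path.nil : Path lvNexus.{0} lvNexus).cons eLamTimes)) := by
  simp only [pathFunctor_cons, pathFunctor_nil, Prefunctor.mapPath_cons, Prefunctor.mapPath_nil]
  rfl

/-- `𝒟_{≤3,[λ^{×pf}]} = 𝒟_{[λ^{×pf}]}`. [cite: MochizukiAbsTopIII2015, Corollary 3.6 (iii) p.80] -/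
theorem sub3_pathFunctor_timesRight :
    datum.sub3.pathFunctor ((Path.nil : Path lvNexus.{0} lvNexus).cons eLamPf) =
      datum.diagram.pathFunctor (embLog.mapPath ((Path.nil : Path lvNexus.{0} lvNexus).cons eLamPf)) := by
  simp only [pathFunctor_cons, pathFunctor_nil, Prefunctor.mapPath_cons, Prefunctor.mapPath_nil]
  rfl

/-- `𝒟_{≤3,[λ^×]∘[id_⋎]∘[log]} = 𝒟_{[λ^×]∘[id_⋎]∘[log]}`. [cite: MochizukiAbsTopIII2015, Corollary 3.6 (iii) p.80] -/
theorem sub3_pathFunctor_logLeft (n : ℤ) :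
    datum.sub3.pathFunctor (logPairLeft.{0} n) = datum.diagram.pathFunctor (embLog.mapPath (logPairLeft.{0} n)) := by
  simp only [logPairLeft, pathFunctor_cons, pathFunctor_nil, Prefunctor.mapPath_cons, Prefunctor.mapPath_nil]
  rfl

/-- `𝒟_{≤3,[λ^{×pf}]∘[id_{⋎+1}]} = 𝒟_{[λ^{×pf}]∘[id_{⋎+1}]}`. [cite: MochizukiAbsTopIII2015, Corollary 3.6 (iii) p.80] -/
theorem sub3_pathFunctor_logRight (n : ℤ) :
    datum.sub3.pathFunctor (logPairRight.{0} n) = datum.diagram.pathFunctor (embLog.mapPath (logPairRight.{0} n)) := by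
  simp only [logPairRight, pathFunctor_cons, pathFunctor_nil, Prefunctor.mapPath_cons, Prefunctor.mapPath_nil]
  rfl

/-- The twisted homotopy of the type-(2) basic pair is `g` (`= ι_×`): weights `0` and `1`.
[cite: MochizukiAbsTopIII2015, Corollary 3.6 (iii) p.81] -/
theorem eta_app_timesPair (x : datum.X) :
    (eta (embLog.mapPath ((Path.nil : Path lvNexus.{0} lvNexus).cons eLamTimes))
      (embLog.mapPath ((Path.nil : Path lvNexus.{0} lvNexus).cons eLamPf))).app x = (gen : Grp) := by
  show ofVal LFVertex.third _ _ _ = _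
  show Multiplicative.ofAdd _ = _
  simp [edgeWt, gen]
  rfl

/-- Weight of `[λ^×]∘[id_⋎]∘[log]` is `0`. [cite: MochizukiAbsTopIII2015, Corollary 3.6 (iii) p.81] -/
theorem pathWt_mapPath_logPairLeft (n : ℤ) : pathWt (embLog.mapPath (logPairLeft.{0} n)) = 0 := by
  simp only [logPairLeft, Prefunctor.mapPath_cons, Prefunctor.mapPath_nil, pathWt_cons, pathWt_nil]
  rfl

/-- Weight of `[λ^{×pf}]∘[id_{⋎+1}]` is `1`. [cite: MochizukiAbsTopIII2015, Corollary 3.6 (iii) p.81] -/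
theorem pathWt_mapPath_logPairRight (n : ℤ) : pathWt (embLog.mapPath (logPairRight.{0} n)) = 1 := by
  simp only [logPairRight, Prefunctor.mapPath_cons, Prefunctor.mapPath_nil, pathWt_cons, pathWt_nil]
  rfl

/-- The twisted homotopy of a type-(1) basic pair is `g` (`= ι_{log,⋎}`).
[cite: MochizukiAbsTopIII2015, Corollary 3.6 (iii) p.81] -/
theorem eta_app_logPair (n : ℤ) (x : datum.X₁) :
    (eta (embLog.mapPath (logPairLeft.{0} n)) (embLog.mapPath (logPairRight.{0} n))).app x = (gen : Grp) := by
  show ofVal LFVertex.third _ _ _ = _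
  show Multiplicative.ofAdd _ = _
  rw [pathWt_mapPath_logPairLeft, pathWt_mapPath_logPairRight]
  rfl

/-- **The pullback of the twisted family is pinned to `ι_×`, `ι_{log,⋎}` on the basic pairs** (`LogPinned`): its
homotopies there are those of the family on the image pairs (compatibility along `𝒟_{≤3} ↪ 𝒟`), i.e. `g`.
[cite: MochizukiAbsTopIII2015, Corollary 3.6 (iii) p.81] -/
theorem logPinned : datum.LogPinned (datum.pullLog family) := by
  refine ⟨⟨pullLog_E_timesPair, fun x e₁ e₂ => ?_⟩, fun n => ⟨pullLog_E_logPair n, fun x e₁ e₂ => ?_⟩⟩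
  · obtain ⟨h', hh⟩ := datum.pullLog_compatibleAlong family _ _ pullLog_E_timesPair
    have H1 : ((datum.pullLog family).η pullLog_E_timesPair).app x =
        (eta (embLog.mapPath ((Path.nil : Path lvNexus.{0} lvNexus).cons eLamTimes))
          (embLog.mapPath ((Path.nil : Path lvNexus.{0} lvNexus).cons eLamPf))).app x :=
      eq_of_heq (heq_app_of_heq sub3_pathFunctor_timesLeft sub3_pathFunctor_timesRight hh x)
    rw [H1]
    exact (eta_app_timesPair x).trans (singleObj_sandwich e₁ (iotaTimes.app x) e₂.symm).symm
  · obtain ⟨h', hh⟩ := datum.pullLog_compatibleAlong family _ _ (pullLog_E_logPair n)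
    have H1 : ((datum.pullLog family).η (pullLog_E_logPair n)).app x =
        (eta (embLog.mapPath (logPairLeft.{0} n)) (embLog.mapPath (logPairRight.{0} n))).app x :=
      eq_of_heq (heq_app_of_heq (sub3_pathFunctor_logLeft n) (sub3_pathFunctor_logRight n) hh x)
    rw [H1]
    exact (eta_app_logPair n x).trans (singleObj_sandwich e₁ (iotaLog.app x) e₂.symm).symm

/-- **The pullback of the twisted family to `𝒟_{≤3}` IS an `𝔖_log` family**: generated by the type-(1)/(2)
pairs, boundary paths ending at `𝒩`, pinned to `ι_{log,⋎}`, `ι_×`. [cite: MochizukiAbsTopIII2015, Corollary 3.6 (iii) p.80] -/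
theorem isLogObservableFamily : datum.IsLogObservableFamily (datum.pullLog family) :=
  ⟨datum.isGeneratedBy_pullLog_of_glueE family (fun _ _ _ _ => Iff.rfl),
    fun _ _ p q h => datum.eq_lvObs_of_saturation_logGen
      ((datum.isGeneratedBy_pullLog_of_glueE family (fun _ _ _ _ => Iff.rfl) p q).mp h),
    logPinned⟩

/-- **The LITERAL Cor. 3.6 (iii) cores clause HOLDS at the twisted datum** (via abc-iut-L4-t5's reduction
`logObsCompatCoresStmt_of_pull` to one family on `𝒟`). [cite: MochizukiAbsTopIII2015, Corollary 3.6 (iii) p.80] -/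
theorem logObsCompatCoresStmt : datum.LogObsCompatCoresStmt :=
  datum.logObsCompatCoresStmt_of_pull family isLogObservableFamily isCore4 isCore5 isCore6

/-- A morphism equal to an `eqToHom` over a loop is the identity. [folklore] -/
private theorem eq_id_of_eq_eqToHom {C : Type*} [Category C] {a : C} (p : a = a) {f : a ⟶ a} (h : f = eqToHom p) :
    f = 𝟙 a := by
  rw [h, eqToHom_refl]

/-- **F-0360 (`IotaOverGaloisStmt`) FAILS at the twisted datum**: the Galois component of `ι_×` is `g ≠ 1`.
[cite: MochizukiAbsTopIII2015, Corollary 3.6 (iii) p.81] -/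
theorem not_iotaOverGaloisStmt : ¬ datum.IotaOverGaloisStmt := by
  rintro ⟨h₁, -⟩
  have h₂ := eq_id_of_eq_eqToHom _ (h₁ (CategoryTheory.SingleObj.star Grp))
  exact gen_ne_one h₂

end TwistedToy

/-! ### The separation -/

/-- **The literal Cor. 3.6 (iii) cores clause does NOT force the identities of F-0360**: there is an abstract
log-Frobenius input datum (`TwistedToy.datum`: all categories `B(ℤ/2)`, all functors identities, `ι_× = ι_{log,⋎}`
the central element `g`) at which ONE family of homotopies on `𝒟` realises `𝔖_log` and the three cores
(`LogObsCompatCoresStmt`) while the Galois component of `ι_×` is NOT the identity (`¬ IotaOverGaloisStmt`).  With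
abc-iut-w5-d053's `logObsCompatCoresStmt_of_iotaOverGaloisStmt`: F-0360 is SUFFICIENT and NOT NECESSARY for the
clause as typed; with abc-iut-f-081's `isIso_NtoE_map_iotaTimes_of_logObsCompatCoresStmt`: the literal clause sits
strictly between "Galois components identities" and the typing, pinning them only up to central automorphisms.
[cite: MochizukiAbsTopIII2015, Corollary 3.6 (iii) pp.80–81] -/
theorem exists_logObsCompatCoresStmt_not_iotaOverGaloisStmt :
    ∃ Δ : LogFrobeniusData.{0}, Δ.LogObsCompatCoresStmt ∧ ¬ Δ.IotaOverGaloisStmt :=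
  ⟨TwistedToy.datum, TwistedToy.logObsCompatCoresStmt, TwistedToy.not_iotaOverGaloisStmt⟩

/-- **Schema form**: the implication "literal cores clause ⟹ F-0360" is NOT valid over the abstract data of
Def. 3.1's shape. [cite: MochizukiAbsTopIII2015, Corollary 3.6 (iii) pp.80–81] -/
theorem not_forall_iotaOverGaloisStmt_of_logObsCompatCoresStmt :
    ¬ ∀ Δ : LogFrobeniusData.{0}, Δ.LogObsCompatCoresStmt → Δ.IotaOverGaloisStmt := fun h =>
  TwistedToy.not_iotaOverGaloisStmt (h _ TwistedToy.logObsCompatCoresStmt)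

end LogFrobeniusData

end Literature.AnabelianGeometry.AbsoluteAnabelian
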